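import Summits.KontsevichZagierPeriods.KontsevichZagierPeriods.Theorems.LiftingCriteriaCubeNashNormalFormReduction
import Summits.KontsevichZagierPeriods.KontsevichZagierPeriods.Theorems.FurushoPentagonReducedPeriodRingDefs
import Literature.NumberTheory.Transcendental.KZCubicalCalculus
import Literature.NumberTheory.Transcendental.KZTameMoveFamily
import Literature.NumberTheory.Transcendental.EllIterRep

/-!
# `CubeNashNormalForm` (stmt-KontsevichZagierPeriods-3574): tame cubes are cube–Nash generators,
# and the item follows from the cube resolution stub of `FurushoPentagon.SectorToKernel`

Support file for the item `CubeNashNormalForm` of route `LiftingCriteria`.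

* `of_mem_of_isTameCube`: a TAME cube representation `t = [[0,1]ⁿ, f]` (`KZ.IntegralRep.IsTameCube`:
  `f` real analytic at every point of the CLOSED cube and `ℚ`-semialgebraic on it — nothing is asked
  outside the cube) lies in every subgroup `N ≥ relations` containing the cube–Nash generators of
  the item (integrand `ℚ`-semialgebraic AND analytic on an OPEN neighbourhood of the closed cube).
  The fold `Φ(s)ᵢ = 3sᵢ² − 2sᵢ³` maps the open box `(−½, 3/2)ⁿ` INTO the closed cube, restricts to a
  Nash diffeomorphism of the closed cube onto itself (Jacobian `∏ 6sᵢ(1 − sᵢ)`, vanishing only on the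
  boundary), so `g = (f ∘ Φ) · ∏ 6sᵢ(1 − sᵢ)` is `ℚ`-semialgebraic and analytic on the whole open box
  and `[t] ≡ [[0,1]ⁿ, g]` is ONE change-of-variables move (`KZ.mem_cubicalCovGens`).
* `cubeNashNormalForm_of_cubeResolution`: hence `CubeNashNormalForm` follows from the statement of
  stub S1 `stub_cubeResolution` of crux `FurushoPentagon.SectorToKernel` (every `[u]` is, modulo
  relations, in the span of the tame cube classes `ReducedPeriodRing.cubicalSpan`); with the tree's
  converse `SectorToKernel.cubeResolution_of_cubeNashNormalForm` the two statements are equivalent.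
[Kontsevich–Zagier 2001, §1.2 rule (2); Ayoub 2014, Def. 10, Rem. 12]
-/

noncomputable section

open Set MeasureTheory Filter Topology MvPolynomial
open Literature.ModelTheory.ExponentialFields (IsSemialgebraic)
open Literature.NumberTheory.Transcendental
open Literature.NumberTheory.Transcendental.KZ
open Summit.KontsevichZagierPeriods.LiftingCriteria.CubeNashNormalFormReduction
  (exists_normalForm_of_mem_sup)

namespace Summit.KontsevichZagierPeriods.LiftingCriteria.CubeNashNormalFormTame

variable {n : ℕ}

/-- The fold `u ↦ 3u² − 2u³` maps `(−½, 3/2)` into `[0, 1]`: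
`3u² − 2u³ = u²(3 − 2u) ≥ 0` and `1 − 3u² + 2u³ = (1 − u)²(1 + 2u) ≥ 0`. [folklore] -/
theorem fold_mem_Icc {u : ℝ} (h1 : -(2 : ℝ)⁻¹ < u) (h2 : u < 3 * 2⁻¹) :
    3 * u ^ 2 - 2 * u ^ 3 ∈ Icc (0 : ℝ) 1 := by
  constructor
  · have : 3 * u ^ 2 - 2 * u ^ 3 = u ^ 2 * (3 - 2 * u) := by ring
    rw [this]
    exact mul_nonneg (sq_nonneg u) (by linarith)
  · have : 1 - (3 * u ^ 2 - 2 * u ^ 3) = (1 - u) ^ 2 * (1 + 2 * u) := by ring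
    nlinarith [mul_nonneg (sq_nonneg (1 - u)) (show (0 : ℝ) ≤ 1 + 2 * u by linarith)]

/-- The fold is strictly increasing on `[0, 1]`:
`φ b − φ a = (b − a)((1 − a)b + (1 − b)a + 2(1 − a)a + 2(1 − b)b)`. [folklore] -/
theorem fold_lt_fold {a b : ℝ} (ha : 0 ≤ a) (hab : a < b) (hb : b ≤ 1) :
    3 * a ^ 2 - 2 * a ^ 3 < 3 * b ^ 2 - 2 * b ^ 3 := by
  have key : (3 * b ^ 2 - 2 * b ^ 3) - (3 * a ^ 2 - 2 * a ^ 3) =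
      (b - a) * ((1 - a) * b + (1 - b) * a + 2 * ((1 - a) * a) + 2 * ((1 - b) * b)) := by ring
  have hb0 : 0 < b := lt_of_le_of_lt ha hab
  have ha1 : a < 1 := lt_of_lt_of_le hab hb
  have hpos : 0 < (1 - a) * b + (1 - b) * a + 2 * ((1 - a) * a) + 2 * ((1 - b) * b) := by
    have h1 : 0 < (1 - a) * b := mul_pos (by linarith) hb0
    have h2 : 0 ≤ (1 - b) * a := mul_nonneg (by linarith) ha
    have h3 : 0 ≤ (1 - a) * a := mul_nonneg (by linarith) ha
    have h4 : 0 ≤ (1 - b) * b := mul_nonneg (by linarith) hb0.le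
    linarith
  have := mul_pos (sub_pos.2 hab) hpos
  linarith

/-- The fold has derivative `6u(1 − u)`. [folklore] -/
theorem hasDerivAt_fold (u : ℝ) :
    HasDerivAt (fun u : ℝ => 3 * u ^ 2 - 2 * u ^ 3) (6 * u * (1 - u)) u := by
  have h1 : HasDerivAt (fun u : ℝ => u ^ 2) (2 * u) u := by simpa using hasDerivAt_pow 2 u
  have h2 : HasDerivAt (fun u : ℝ => u ^ 3) (3 * u ^ 2) u := by simpa using hasDerivAt_pow 3 u
  have h := (h1.const_mul 3).sub (h2.const_mul 2)
  have e : 3 * (2 * u) - 2 * (3 * u ^ 2) = 6 * u * (1 - u) := by ring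
  rw [e] at h
  exact h

/-- The fold maps `[0, 1]` onto `[0, 1]`. [folklore] -/
theorem fold_image_Icc : (fun u : ℝ => 3 * u ^ 2 - 2 * u ^ 3) '' Icc 0 1 = Icc 0 1 := by
  apply Subset.antisymm
  · rintro _ ⟨u, hu, rfl⟩
    exact fold_mem_Icc (by linarith [hu.1]) (by linarith [hu.2])
  · have hc : ContinuousOn (fun u : ℝ => 3 * u ^ 2 - 2 * u ^ 3) (Icc 0 1) := by fun_prop
    have h := intermediate_value_Icc zero_le_one hc
    norm_num at h
    exact h

/-- **Tame cubes are cube–Nash generators modulo one change of variables.** See the module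
docstring. [cite: KontsevichZagier2001, §1.2 rule (2)] -/
theorem of_mem_of_isTameCube (N : AddSubgroup FormalRep) (hrel : relations ≤ N)
    (hgen : ∀ {m : ℕ} (t : IntegralRep m) (g : (Fin m → ℝ) → ℝ) (U : Set (Fin m → ℝ)),
      IsOpen U → Set.pi Set.univ (fun _ : Fin m => Set.Icc (0:ℝ) 1) ⊆ U →
      IsSemialgebraicFunOn ℚ U g → AnalyticOnNhd ℝ g U →
      t.domain = Set.pi Set.univ (fun _ : Fin m => Set.Icc (0:ℝ) 1) →
      (∀ z ∈ Set.pi Set.univ (fun _ : Fin m => Set.Icc (0:ℝ) 1), t.integrand z = g z) → of t ∈ N)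
    (t : IntegralRep n) (ht : t.IsTameCube) : of t ∈ N := by
  classical
  -- the fold, its derivative and its Jacobian
  set Φ : (Fin n → ℝ) → (Fin n → ℝ) := fun s i => 3 * s i ^ 2 - 2 * s i ^ 3 with hΦ
  set Φ' : (Fin n → ℝ) → (Fin n → ℝ) →L[ℝ] (Fin n → ℝ) := fun s =>
    LinearMap.toContinuousLinearMap
      (Matrix.toLin' (Matrix.diagonal fun i : Fin n => 6 * s i * (1 - s i))) with hΦ'
  set J : (Fin n → ℝ) → ℝ := fun s => ∏ i, 6 * s i * (1 - s i) with hJ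
  have hΦ'apply : ∀ s v : Fin n → ℝ, Φ' s v = fun i => 6 * s i * (1 - s i) * v i := by
    intro s v
    ext i
    simp [hΦ', Matrix.mulVec_diagonal]
  have hdet : ∀ s, (Φ' s).det = J s := fun s => by
    simp [hΦ', hJ, LinearMap.det_toLin', Matrix.det_diagonal]
  have hderiv : ∀ s, HasFDerivAt Φ (Φ' s) s := by
    intro s
    refine hasFDerivAt_pi'' fun i => ?_
    have h1 : HasFDerivAt (fun x : Fin n → ℝ => x i)
        (ContinuousLinearMap.proj (R := ℝ) (φ := fun _ : Fin n => ℝ) i) s :=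
      hasFDerivAt_apply (𝕜 := ℝ) i s
    have h2 := (hasDerivAt_fold (s i)).comp_hasFDerivAt s h1
    have he : (ContinuousLinearMap.proj i).comp (Φ' s) =
        (6 * s i * (1 - s i)) • (ContinuousLinearMap.proj i : (Fin n → ℝ) →L[ℝ] ℝ) := by
      ext v
      simp [hΦ'apply]
    rw [he]
    exact h2
  -- the open box `U = (−½, 3/2)ⁿ`
  set U : Set (Fin n → ℝ) := Set.pi univ fun _ => Ioo (-(2 : ℝ)⁻¹) (3 * 2⁻¹) with hU
  have hUo : IsOpen U := isOpen_set_pi finite_univ fun _ _ => isOpen_Ioo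
  have hcubeU : Set.pi Set.univ (fun _ : Fin n => Set.Icc (0:ℝ) 1) ⊆ U := by
    intro s hs
    simp only [hU, mem_univ_pi, mem_Ioo]
    intro i
    have := (mem_univ_pi.1 hs) i
    constructor <;> nlinarith [this.1, this.2]
  have h2a : IsAlgebraic ℚ (2 : ℝ) := by exact_mod_cast isAlgebraic_nat 2
  have h3a : IsAlgebraic ℚ (3 : ℝ) := by exact_mod_cast isAlgebraic_nat 3
  have hUsa : IsSemialgebraic ℚ U := by
    have hUeq : U = ⋂ i ∈ (Finset.univ : Finset (Fin n)),
        ({s : Fin n → ℝ | -(2 : ℝ)⁻¹ < s i} ∩ {s : Fin n → ℝ | s i < 3 * 2⁻¹}) := by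
      ext s
      simp [hU]
    rw [hUeq]
    exact IsSemialgebraic.biInter _ _ fun i _ =>
      (isSemialgebraic_setOf_const_lt_apply h2a.inv.neg i).inter
        (isSemialgebraic_setOf_apply_lt_const (h3a.mul h2a.inv) i)
  -- `Φ` maps `U` into the closed cube, the closed cube onto itself, injectively
  have hΦU : ∀ s ∈ U, Φ s ∈ cube n := by
    intro s hs i
    have h := (mem_univ_pi.1 hs) i
    exact ⟨(fold_mem_Icc h.1 h.2).1, (fold_mem_Icc h.1 h.2).2⟩
  have hΦcube : ∀ s ∈ cube n, Φ s ∈ cube n := fun s hs =>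
    hΦU s (hcubeU ((cube_eq_pi n) ▸ hs))
  have hinj : InjOn Φ (cube n) := by
    intro a ha b hb hab
    funext i
    have h : 3 * a i ^ 2 - 2 * a i ^ 3 = 3 * b i ^ 2 - 2 * b i ^ 3 := congrFun hab i
    rcases lt_trichotomy (a i) (b i) with hlt | heq | hgt
    · exact absurd h (fold_lt_fold (ha i).1 hlt (hb i).2).ne
    · exact heq
    · exact absurd h (fold_lt_fold (hb i).1 hgt (ha i).2).ne'
  have himg : Φ '' cube n = cube n := by
    apply Subset.antisymm
    · rintro _ ⟨s, hs, rfl⟩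
      exact hΦcube s hs
    · intro y hy
      have hyi : ∀ i, ∃ u ∈ Icc (0 : ℝ) 1, 3 * u ^ 2 - 2 * u ^ 3 = y i := fun i => by
        have : y i ∈ (fun u : ℝ => 3 * u ^ 2 - 2 * u ^ 3) '' Icc 0 1 := by
          rw [fold_image_Icc]; exact ⟨(hy i).1, (hy i).2⟩
        exact this
      choose x hx hxy using hyi
      exact ⟨x, fun i => ⟨(hx i).1, (hx i).2⟩, funext fun i => hxy i⟩
  -- semialgebraicity and analyticity of `Φ`
  set P : Fin n → MvPolynomial (Fin n) ℚ := fun j => 3 * X j ^ 2 - 2 * X j ^ 3 with hP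
  have hΦP : (fun (x : Fin n → ℝ) j => aeval x (P j)) = Φ := by
    funext x j
    simp [hP, hΦ]
  have hΦs : IsSemialgebraicMapOn ℚ (cube n) Φ := hΦP ▸ isSemialgebraicMapOn_aeval isSemialgebraic_cube P
  have hproj : ∀ (i : Fin n) (s : Fin n → ℝ), AnalyticAt ℝ (fun x : Fin n → ℝ => x i) s :=
    fun i s => (ContinuousLinearMap.proj (R := ℝ) (φ := fun _ : Fin n => ℝ) i).analyticAt s
  have hcoord : ∀ (i : Fin n) (s : Fin n → ℝ),
      AnalyticAt ℝ (fun x : Fin n → ℝ => 3 * x i ^ 2 - 2 * x i ^ 3) s := fun i s =>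
    (analyticAt_const.mul ((hproj i s).pow 2)).sub (analyticAt_const.mul ((hproj i s).pow 3))
  have hΦan : ∀ s, AnalyticAt ℝ Φ s := fun s => by
    rw [hΦ]
    exact AnalyticAt.pi fun i => hcoord i s
  have hΦa : ∀ i : Fin n, AnalyticOnNhd ℝ (fun x : Fin n → ℝ => Φ x i) (cube n) :=
    fun i s _ => hcoord i s
  have hJan : ∀ s, AnalyticAt ℝ J s := fun s => by
    rw [hJ]
    exact Finset.analyticAt_fun_prod _ fun i _ =>
      (analyticAt_const.mul (hproj i s)).mul (analyticAt_const.sub (hproj i s))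
  -- the new integrand `g = (f ∘ Φ) · J` on `U`
  set f : (Fin n → ℝ) → ℝ := t.integrand with hf
  set g : (Fin n → ℝ) → ℝ := fun s => f (Φ s) * J s with hg
  have hgan : AnalyticOnNhd ℝ g U := fun s hs =>
    ((ht.2 (Φ s) (hΦU s hs)).comp (hΦan s)).mul (hJan s)
  have hgsa : IsSemialgebraicFunOn ℚ U g := by
    have h1 : IsSemialgebraicFunOn ℚ (Φ ⁻¹' cube n) (fun s => f (Φ s)) := by
      have h := ht.isSemialgebraicFunOn.comp_aeval P
      rw [hΦP] at h
      exact h.congr fun x _ => congrArg t.integrand (congrFun hΦP x)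
    have h2 : IsSemialgebraicFunOn ℚ U (fun s => f (Φ s)) := h1.mono (fun s hs => hΦU s hs) hUsa
    have h3 : IsSemialgebraicFunOn ℚ U J := by
      refine (isSemialgebraicFunOn_aeval hUsa (∏ i, (6 * X i * (1 - X i) : MvPolynomial (Fin n) ℚ))).congr
        fun s _ => ?_
      simp [hJ, map_prod]
    exact IsSemialgebraicFunOn.mul_holds h2 h3
  -- the new representation `r = [[0,1]ⁿ, g]`
  have hgc : ContinuousOn g (Set.pi Set.univ fun _ : Fin n => Set.Icc (0:ℝ) 1) := fun s hs =>
    (hgan s (hcubeU hs)).continuousAt.continuousWithinAt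
  let r : IntegralRep n :=
    { domain := Set.pi Set.univ fun _ : Fin n => Set.Icc (0:ℝ) 1
      integrand := g
      isSemialgebraic_domain := (cube_eq_pi n) ▸ isSemialgebraic_cube
      isSemialgebraicFunOn_integrand := hgsa.mono hcubeU ((cube_eq_pi n) ▸ isSemialgebraic_cube)
      integrableOn := hgc.integrableOn_compact (isCompact_univ_pi fun _ => isCompact_Icc) }
  have hr : r.IsTameCube := ⟨(cube_eq_pi n).symm, fun s hs => hgan s (hcubeU ((cube_eq_pi n) ▸ hs))⟩
  -- the change-of-variables move `[r] − [t]`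
  have hcov : of r - of t ∈ cubicalCovGens := by
    refine mem_cubicalCovGens hr ht hΦs (fun s _ => (hderiv s).hasFDerivWithinAt) hinj himg hΦa
      fun s hs => ?_
    rw [hdet, abs_of_nonneg (Finset.prod_nonneg fun i _ =>
      mul_nonneg (mul_nonneg (by norm_num) (hs i).1) (sub_nonneg.2 (hs i).2))]
  have hrN : of r ∈ N := hgen r g U hUo hcubeU hgsa hgan rfl fun _ _ => rfl
  have : of t = of r - (of r - of t) := by abel
  rw [this]
  exact N.sub_mem hrN (hrel (cubicalCovGens_subset_relations hcov))

/-- **`CubeNashNormalForm` from the cube resolution stub.** If every representation is, modulo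
the relations, a `ℤ`-combination of tame cube classes (the statement of stub S1
`stub_cubeResolution` of crux `FurushoPentagon.SectorToKernel`, byte-identical with S1b of
`ReducedPeriodRing`), then `CubeNashNormalForm` holds: tame cube classes lie in the subgroup
generated by relations and cube–Nash generators (`of_mem_of_isTameCube`), and the normal form is
read off (`exists_normalForm_of_mem_sup`). Converse: `SectorToKernel.cubeResolution_of_cubeNashNormalForm`.
[cite: KontsevichZagier2001, §1.2; Ayoub2014, Rem. 12] -/
theorem cubeNashNormalForm_of_cubeResolution
    (h : ∀ (m : ℕ) (u : IntegralRep m), ∃ c : FormalRep,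
      c ∈ Summit.KontsevichZagierPeriods.FurushoPentagon.ReducedPeriodRing.cubicalSpan ∧
        of u - c ∈ relations) :
    Summit.KontsevichZagierPeriods.KontsevichZagierPeriods.Theses.LiftingCriteria.CubeNashNormalForm := by
  intro k k' r r' _ _
  set N : AddSubgroup FormalRep := relations ⊔ AddSubgroup.closure {x : FormalRep | ∃ (m : ℕ)
      (t : IntegralRep m) (g : (Fin m → ℝ) → ℝ) (U : Set (Fin m → ℝ)), IsOpen U ∧
      Set.pi Set.univ (fun _ : Fin m => Set.Icc (0:ℝ) 1) ⊆ U ∧ IsSemialgebraicFunOn ℚ U g ∧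
      AnalyticOnNhd ℝ g U ∧ t.domain = Set.pi Set.univ (fun _ : Fin m => Set.Icc (0:ℝ) 1) ∧
      (∀ z ∈ Set.pi Set.univ (fun _ : Fin m => Set.Icc (0:ℝ) 1), t.integrand z = g z) ∧ x = of t}
    with hN
  have hrel : relations ≤ N := le_sup_left
  have hgen : ∀ {m : ℕ} (t : IntegralRep m) (g : (Fin m → ℝ) → ℝ) (U : Set (Fin m → ℝ)),
      IsOpen U → Set.pi Set.univ (fun _ : Fin m => Set.Icc (0:ℝ) 1) ⊆ U →
      IsSemialgebraicFunOn ℚ U g → AnalyticOnNhd ℝ g U →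
      t.domain = Set.pi Set.univ (fun _ : Fin m => Set.Icc (0:ℝ) 1) →
      (∀ z ∈ Set.pi Set.univ (fun _ : Fin m => Set.Icc (0:ℝ) 1), t.integrand z = g z) → of t ∈ N :=
    fun t g U h1 h2 h3 h4 h5 h6 =>
      AddSubgroup.mem_sup_right (AddSubgroup.subset_closure ⟨_, t, g, U, h1, h2, h3, h4, h5, h6, rfl⟩)
  have hspan : Summit.KontsevichZagierPeriods.FurushoPentagon.ReducedPeriodRing.cubicalSpan ≤ N := by
    refine (AddSubgroup.closure_le _).2 ?_
    rintro _ ⟨m, t, htd, hta, rfl⟩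
    exact of_mem_of_isTameCube N hrel hgen t ⟨htd, hta⟩
  have hu : ∀ (m : ℕ) (u : IntegralRep m), of u ∈ N := fun m u => by
    obtain ⟨c, hc, e⟩ := h m u
    have : of u = (of u - c) + c := by abel
    rw [this]
    exact N.add_mem (hrel e) (hspan hc)
  exact exists_normalForm_of_mem_sup (N.sub_mem (hu k r) (hu k' r'))

end Summit.KontsevichZagierPeriods.LiftingCriteria.CubeNashNormalFormTame
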